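import Summits.QuantumFields.YangMills.Theorems.BalabanUVNodesN15KingModelFreeRGDatum
import HarnessLib

/-!
# BalabanUVNodes ∕ N15 — THE KING-MODEL RUNG, FREE-FIELD EDITION (PART Τ-f₁, LETTERS FOR THEOREM 3.4): the members of (3.9) for the free-field
# datum in letters — the threshold letter `R_m² ≤ b₀²L^{2p+2}ε_m^{−2p−2}`, (3.92) `|½⟨φ,(Δ^{(k)}−Δ^{(k+n)})φ⟩| ≤ ½Θ L^{−2k}a⟨φ,φ⟩`, (3.93)
# determinant-free `|ln 𝒩(Δ^{(k)}) − ln 𝒩(Δ^{(k+n)})| ≤ |T₁^{(k)}|ΘL^{−2k}Λ`, the rate-free member `k = 0`, and the `ε_m`-bookkeeping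
# (Track A, DAG node N15 = NE2; FAN-OUT v1.1 §N15 s3 «KING-MODEL RUNG»; regen R453 (b))

HONEST FRAMING.  Count-neutral (cell `pub-ymgap`, seat `pub-ymgap-dag-n15-e` g19; `--supports stmt-QuantumFields-27366 --as helper` = K3⁸
`SpineGivenEndpointR13SepCoPHV`).  TEMPLATE LITERATURE, `A = 0`: the letter half of [King1986] Theorem 3.4 (3.9) BY NAME for the free massive lattice
scalar field (part Τ-f `thm34Printed_kingFreeRG` assembles these).  King's §3.6 route p. 668–669 for the Gaussian part of `S^{(k),1}`: the quadratic
term by Prop. 3.10 (3.91) ⇒ (3.92), the normalisations by (3.93) — here (3.91) AS FORMS is part Τ-d `kingEffLap_forms_rate` (typer's `lemma43_aK` +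
`effLaplacian_form_DeltaEff`, zero mode included) and (3.93)'s right-hand side `CL^{−2k}(L^kε)^{−d}|T|` is part Τ-a `abs_log_gaussNorm_sub_le` (form
comparison + Lebesgue scaling, NO determinant), with the crude sandwich `abs_log_gaussNorm_sub_le_crude` for the finitely many `k` with `ΘL^{−2k} > ½` and
for the rate-free member `k = 0` (bare action vs. `Δ^{(n)}`).  §1 letters (`ε_{m+1} = ε_m∕L`, `Σ_yφ(y)² ≤ |T₁|R_m²` on `χ = 1`,
`p(ε) ≤ b₀ε^{−p}`, `R_m² ≤ b₀²L^{2p+2}ε_m^{−(2p+2)}`); §2 ★ `log_gaussNorm_rate`; §3 ★ `kingFreeS_diff_rate` (`k, n ≥ 1`), `kingFreeS_diff_zero` (`k = 0`);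
§4 `|T₁^{(k)}| = |T|ε_m^{−d}`, `Λ ≤ Λ₀ε_m^{−2}` (`lambda0` explicit), `⟨φ,φ⟩ ≤ |T|b₀²L^{2p+2}ε_m^{−(d+2p+2)}`.
HONEST SCOPE: datum of part Τ-e (cubic torus, `h = g = 0`, φ-clause of (3.2) at `λ := 1`, `S^{(k),1}` in closed Gaussian form); `L ≥ 2`, `a, m² > 0`,
`b₀, p ≥ 0`, any `d`.  NOT Bałaban's objects; NOT the interacting model's (3.9); NOT a node discharge; nothing continuum-YM ∕ ℝ⁴ ∕ OS ∕ mass-gap ∕ Clay.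
0 `sorry`; ONE reducible abbreviation (`lambda0`, the constants letter); standard axioms.
Locators: [King1986] (3.1)–(3.2) p.655, Thm 3.4 (3.9) p.656, (3.14) p.657, Prop. 3.10 (3.91)–(3.93) pp.668–669.
-/

noncomputable section

namespace Summit.QuantumFields.YangMills.BalabanUVNodes.N15KingModelRung.FreeField

open Real Finset Matrix MeasureTheory
open Literature.MathematicalPhysics.QuantumFieldTheory.Balaban1983to89 (B2.pFn)
open Literature.MathematicalPhysics.QuantumFieldTheory.Balaban1983to89.B5Prop11Plancherel (Tor)
open Literature.MathematicalPhysics.QuantumFieldTheory.Balaban1983to89.QGQInverse (Coercive)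
open Literature.LinearAlgebra.Matrix (dotProduct_self_nonneg_real)
open Literature.MathematicalPhysics.QuantumFieldTheory.King1986.Torus (lapF)
open Literature.MathematicalPhysics.QuantumFieldTheory.King1986.ContinuumLimit (eps eps_pos eps_le_one RGData)

variable {d : ℕ}

/-! ## §1 Letters: `ε_m`, the site count, the threshold -/

/-- `ε_{m+1} = ε_m ∕ L`. [cite: King1986, p.654 («ε_K = L^{−K}»)] -/
theorem eps_succ {L : ℕ} (hL : 0 < L) (m : ℕ) : eps L (m + 1) = eps L m / L := by
  have hL0 : (L : ℝ) ≠ 0 := by exact_mod_cast hL.ne'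
  unfold eps
  rw [pow_succ, mul_inv, div_eq_mul_inv]

/- The letter `|ln x| ≤ x + x⁻¹` (`x > 0`) is the tree's `Literature.NumberTheory.Automorphic.abs_log_le_add_inv`; to keep the import closure inside
the QFT corner it is re-derived INLINE (two `Real.log_le_sub_one_of_pos`) where used, not re-declared. -/

/-- On the small-field set `Σ_y φ(y)² ≤ |T₁^{(k)}|·R_m²` (`|φ(y)| ≤ R_m` for all `y`). [cite: King1986, (3.2) p.655, (3.92) p.669] -/
theorem dotProduct_self_le_of_chi {L : ℕ} [NeZero L] {M₀ : ℕ} [NeZero M₀] {b₀ p : ℝ} {m : ℕ} {φ : Tor (cubeSide (d := d) M₀ L m) → ℝ}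
    (hχ : kingFreeChi L M₀ b₀ p m φ = 1) :
    φ ⬝ᵥ φ ≤ (Fintype.card (Tor (cubeSide (d := d) M₀ L m)) : ℝ) * kingFreeThreshold d b₀ p L m ^ 2 := by
  rw [kingFreeChi_eq_one_iff] at hχ
  have h : φ ⬝ᵥ φ = ∑ y, φ y ^ 2 := by simp [dotProduct, sq]
  rw [h]
  calc ∑ y, φ y ^ 2 ≤ ∑ _y : Tor (cubeSide (d := d) M₀ L m), kingFreeThreshold d b₀ p L m ^ 2 :=
        Finset.sum_le_sum fun y _ => by
          have := hχ y
          rw [← sq_abs]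
          exact pow_le_pow_left₀ (abs_nonneg _) this 2
    _ = _ := by rw [Finset.sum_const, Finset.card_univ, nsmul_eq_mul]

/-- `p(ε) ≤ b₀ε^{−p}` for `0 < ε ≤ 1`, `b₀ ≥ 0`, `p ≥ 0` (`1 + ln ε⁻¹ ≤ ε⁻¹`). [cite: King1986, (3.1) p.655] -/
theorem pFn_le_rpow {b₀ p ε : ℝ} (hb : 0 ≤ b₀) (hp : 0 ≤ p) (hε : 0 < ε) (hε1 : ε ≤ 1) : B2.pFn b₀ p ε ≤ b₀ * ε ^ (-p) := by
  rw [Literature.MathematicalPhysics.QuantumFieldTheory.King1986.ContinuumLimit.pFn_eq]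
  have hinv : 1 ≤ ε⁻¹ := one_le_inv_iff₀.mpr ⟨hε, hε1⟩
  have hlog0 : 0 ≤ Real.log ε⁻¹ := Real.log_nonneg hinv
  have h1 : 1 + Real.log ε⁻¹ ≤ ε⁻¹ := by
    have := Real.log_le_sub_one_of_pos (inv_pos.mpr hε)
    linarith
  have h2 : (1 + Real.log ε⁻¹) ^ p ≤ ε⁻¹ ^ p := Real.rpow_le_rpow (by linarith) h1 hp
  rw [Real.inv_rpow hε.le, ← Real.rpow_neg hε.le] at h2
  exact mul_le_mul_of_nonneg_left h2 hb

/-- **The threshold letter**: `R_m² ≤ b₀²·L^{2p+2}·ε_m^{−(2p+2)}` (`R_m = p(ε_{m+1})ε_{m+1}^{−(4−d)∕4}`, `(4−d)∕4 ≤ 1`, `ε_{m+1} = ε_m∕L`).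
[cite: King1986, (3.1)–(3.2) p.655] -/
theorem threshold_sq_le {L : ℕ} (hL : 2 ≤ L) {b₀ p : ℝ} (hb : 0 ≤ b₀) (hp : 0 ≤ p) (m : ℕ) :
    kingFreeThreshold d b₀ p L m ^ 2 ≤ b₀ ^ 2 * (L : ℝ) ^ (2 * p + 2) * eps L m ^ (-(2 * p + 2)) := by
  have hL0 : 0 < L := by omega
  have hLr : (0 : ℝ) < L := by exact_mod_cast hL0
  have hε1pos : 0 < eps L (m + 1) := eps_pos hL0 (m + 1)
  have hε1le : eps L (m + 1) ≤ 1 := eps_le_one (by omega) (m + 1)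
  have hεpos : 0 < eps L m := eps_pos hL0 m
  -- R ≤ b₀ ε₁^{−p} · ε₁^{−1}
  have hA : B2.pFn b₀ p (eps L (m + 1)) ≤ b₀ * eps L (m + 1) ^ (-p) := pFn_le_rpow hb hp hε1pos hε1le
  have hB : eps L (m + 1) ^ (-((4 - (d : ℝ)) / 4)) ≤ eps L (m + 1) ^ (-(1 : ℝ)) :=
    Real.rpow_le_rpow_of_exponent_ge hε1pos hε1le (by
      have : (0 : ℝ) ≤ d := Nat.cast_nonneg d
      linarith)
  have hA0 : 0 ≤ B2.pFn b₀ p (eps L (m + 1)) := by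
    rw [Literature.MathematicalPhysics.QuantumFieldTheory.King1986.ContinuumLimit.pFn_eq]
    have hinv : 1 ≤ (eps L (m + 1))⁻¹ := one_le_inv_iff₀.mpr ⟨hε1pos, hε1le⟩
    have := Real.log_nonneg hinv
    exact mul_nonneg hb (Real.rpow_nonneg (by linarith) _)
  have hB0 : 0 ≤ eps L (m + 1) ^ (-((4 - (d : ℝ)) / 4)) := Real.rpow_nonneg hε1pos.le _
  have hR : kingFreeThreshold d b₀ p L m ≤ b₀ * eps L (m + 1) ^ (-(p + 1)) := by
    unfold kingFreeThreshold
    calc B2.pFn b₀ p (eps L (m + 1)) * eps L (m + 1) ^ (-((4 - (d : ℝ)) / 4))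
        ≤ (b₀ * eps L (m + 1) ^ (-p)) * eps L (m + 1) ^ (-(1 : ℝ)) := mul_le_mul hA hB hB0 (by positivity)
      _ = b₀ * eps L (m + 1) ^ (-(p + 1)) := by
          rw [mul_assoc, ← Real.rpow_add hε1pos]; ring_nf
  have hR0 : 0 ≤ kingFreeThreshold d b₀ p L m := by unfold kingFreeThreshold; exact mul_nonneg hA0 hB0
  -- square and rewrite ε₁ = ε∕L
  have hsq : kingFreeThreshold d b₀ p L m ^ 2 ≤ (b₀ * eps L (m + 1) ^ (-(p + 1))) ^ 2 := pow_le_pow_left₀ hR0 hR 2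
  refine hsq.trans (le_of_eq ?_)
  rw [mul_pow, ← Real.rpow_natCast (eps L (m + 1) ^ (-(p + 1))) 2, ← Real.rpow_mul hε1pos.le, eps_succ hL0,
    Real.div_rpow hεpos.le hLr.le]
  push_cast
  have e1 : -(p + 1) * (2 : ℝ) = -(2 * p + 2) := by ring
  rw [e1, Real.rpow_neg hLr.le (2 * p + 2), div_inv_eq_mul]
  ring

/-! ## §2 The per-member bounds in letters: the quadratic term (3.92) and the constants (3.93) -/

section Members

variable (L : ℕ) [NeZero L] (M₀ : ℕ) [NeZero M₀]

/-- ★ **THE CONSTANTS, (3.93) determinant-free**: for `k, n ≥ 1`, with `t = Θ(a,L)L^{−2k}`, the two Gaussian normalisations on `T₁^{(k)}` satisfy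
`|ln 𝒩(Δ^{(k)}) − ln 𝒩(Δ^{(k+n)})| ≤ |T₁^{(k)}|·t·(1 + |ln A| + |ln δ|)`, `A = a + m2 + 4d`, `δ = δ(a,L,m2)` — part Τ-a's sharp comparison when `t ≤ ½`
(rate `|T₁|·t` = King's `CΣ_pL^{−2k}`), its crude sandwich otherwise. [cite: King1986, (3.93) p.669] -/
theorem log_gaussNorm_rate {a : ℝ} (ha : 0 < a) (hL : 2 ≤ L) {k n : ℕ} (hk : 1 ≤ k) (hn : 1 ≤ n) {m2 : ℝ} (hm : 0 < m2)
    (M : Fin d → ℕ) [∀ μ, NeZero (M μ)] :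
    |Real.log (gaussNorm (kingEffLap L M a m2 k)) - Real.log (gaussNorm (kingEffLap L M a m2 (k + n)))|
      ≤ (Fintype.card (Tor M) : ℝ) * (thetaUnif a L * ((L : ℝ) ^ (2 * k))⁻¹)
          * (1 + |Real.log (a + m2 + 4 * d)| + |Real.log (deltaFloor a L m2)|) := by
  set t : ℝ := thetaUnif a L * ((L : ℝ) ^ (2 * k))⁻¹ with ht
  have hΘ := thetaUnif_pos ha hL
  have hL1 : (1 : ℝ) ≤ L := by exact_mod_cast (show 1 ≤ L by omega)
  have ht0 : 0 < t := by rw [ht]; positivity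
  obtain ⟨hδ, hδm⟩ := deltaFloor_pos_le L ha hL hm
  have hc1 : Coercive (kingEffLap L M a m2 k) (deltaFloor a L m2) := kingEffLap_coercive L M ha hL hk hm
  have hc2 : Coercive (kingEffLap L M a m2 (k + n)) (deltaFloor a L m2) := kingEffLap_coercive L M ha hL (by omega) hm
  have hA : 0 < a + m2 + 4 * d := by positivity
  have hA1 : ∀ x, x ⬝ᵥ (kingEffLap L M a m2 k *ᵥ x) ≤ (a + m2 + 4 * d) * (x ⬝ᵥ x) := fun x =>
    (kingEffLap_form_le L M ha hL hk hm x).trans (mul_le_mul_of_nonneg_right (by linarith [hm.le, (by positivity : (0:ℝ) ≤ 4 * d)])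
      (dotProduct_self_nonneg_real x))
  have hA2 : ∀ x, x ⬝ᵥ (kingEffLap L M a m2 (k + n) *ᵥ x) ≤ (a + m2 + 4 * d) * (x ⬝ᵥ x) := fun x =>
    (kingEffLap_form_le L M ha hL (by omega) hm x).trans (mul_le_mul_of_nonneg_right (by linarith [hm.le, (by positivity : (0:ℝ) ≤ 4 * d)])
      (dotProduct_self_nonneg_real x))
  have hΛ1 : (1 : ℝ) ≤ 1 + |Real.log (a + m2 + 4 * d)| + |Real.log (deltaFloor a L m2)| := by
    have := abs_nonneg (Real.log (a + m2 + 4 * d)); have := abs_nonneg (Real.log (deltaFloor a L m2)); linarith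
  have hcard : (0 : ℝ) < Fintype.card (Tor M) := card_tor_pos M
  -- the crude bound, valid always
  have hcrude := abs_log_gaussNorm_sub_le_crude hδ hA hc1 hA1 hc2 hA2
  by_cases hts : t ≤ 1 / 2
  · -- sharp: |q₁ − q₂| ≤ θ q₁ ≤ t q₁
    have hθ : thetaK a L k n ≤ t := thetaK_le ha hL hk hn
    have hrate := kingEffLap_forms_rate L M ha hL hk hn hm
    have hq0 : ∀ x, 0 ≤ x ⬝ᵥ (kingEffLap L M a m2 k *ᵥ x) := fun x =>
      le_trans (mul_nonneg hδ.le (dotProduct_self_nonneg_real x)) (hc1 x)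
    have hlo : ∀ x, (1 - t) * (x ⬝ᵥ (kingEffLap L M a m2 k *ᵥ x)) ≤ x ⬝ᵥ (kingEffLap L M a m2 (k + n) *ᵥ x) := fun x => by
      have h := (abs_le.mp ((hrate x).trans (mul_le_mul_of_nonneg_right hθ (hq0 x)))).2
      linarith
    have hhi : ∀ x, x ⬝ᵥ (kingEffLap L M a m2 (k + n) *ᵥ x) ≤ (1 + t) * (x ⬝ᵥ (kingEffLap L M a m2 k *ᵥ x)) := fun x => by
      have h := (abs_le.mp ((hrate x).trans (mul_le_mul_of_nonneg_right hθ (hq0 x)))).1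
      linarith
    have hsharp := abs_log_gaussNorm_sub_le hδ hc1 ht0.le hts hlo hhi
    rw [abs_sub_comm] at hsharp
    calc |Real.log (gaussNorm (kingEffLap L M a m2 k)) - Real.log (gaussNorm (kingEffLap L M a m2 (k + n)))|
        ≤ (Fintype.card (Tor M) : ℝ) * t := hsharp
      _ = (Fintype.card (Tor M) : ℝ) * t * 1 := by ring
      _ ≤ (Fintype.card (Tor M) : ℝ) * t * (1 + |Real.log (a + m2 + 4 * d)| + |Real.log (deltaFloor a L m2)|) :=
          mul_le_mul_of_nonneg_left hΛ1 (by positivity)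
  · -- crude: ½(ln A − ln δ) ≤ ½(|ln A| + |ln δ|) ≤ t(|ln A| + |ln δ|) ≤ tΛ since t > ½
    push Not at hts
    have hsum0 : 0 ≤ |Real.log (a + m2 + 4 * d)| + |Real.log (deltaFloor a L m2)| := by positivity
    have hstep : (1 : ℝ) / 2 * (Real.log (a + m2 + 4 * d) - Real.log (deltaFloor a L m2))
        ≤ t * (1 + |Real.log (a + m2 + 4 * d)| + |Real.log (deltaFloor a L m2)|) := by
      have h1 : Real.log (a + m2 + 4 * d) - Real.log (deltaFloor a L m2)
          ≤ |Real.log (a + m2 + 4 * d)| + |Real.log (deltaFloor a L m2)| := by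
        linarith [le_abs_self (Real.log (a + m2 + 4 * d)), neg_abs_le (Real.log (deltaFloor a L m2))]
      calc (1 : ℝ) / 2 * (Real.log (a + m2 + 4 * d) - Real.log (deltaFloor a L m2))
          ≤ (1 : ℝ) / 2 * (|Real.log (a + m2 + 4 * d)| + |Real.log (deltaFloor a L m2)|) := by linarith
        _ ≤ t * (|Real.log (a + m2 + 4 * d)| + |Real.log (deltaFloor a L m2)|) := mul_le_mul_of_nonneg_right hts.le hsum0
        _ ≤ t * (1 + |Real.log (a + m2 + 4 * d)| + |Real.log (deltaFloor a L m2)|) :=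
            mul_le_mul_of_nonneg_left (by linarith) ht0.le
    calc |Real.log (gaussNorm (kingEffLap L M a m2 k)) - Real.log (gaussNorm (kingEffLap L M a m2 (k + n)))|
        ≤ (Fintype.card (Tor M) : ℝ) / 2 * (Real.log (a + m2 + 4 * d) - Real.log (deltaFloor a L m2)) := hcrude
      _ = (Fintype.card (Tor M) : ℝ) * ((1 : ℝ) / 2 * (Real.log (a + m2 + 4 * d) - Real.log (deltaFloor a L m2))) := by ring
      _ ≤ (Fintype.card (Tor M) : ℝ) * (t * (1 + |Real.log (a + m2 + 4 * d)| + |Real.log (deltaFloor a L m2)|)) :=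
          mul_le_mul_of_nonneg_left hstep hcard.le
      _ = _ := by ring

end Members

/-! ## §3 The members of (3.9) in letters: `k, n ≥ 1` (rated), `k = 0` (rate-free), `n = 0` (zero) -/

section Members2

variable (L : ℕ) [NeZero L] (M₀ : ℕ) [NeZero M₀]

/-- ★ **THE RATED MEMBER** (`k, n ≥ 1`): `|S^{(k),1}(φ) − S^{(k+n),1}(φ)| ≤ Θ L^{−2k}·[½a⟨φ,φ⟩ + |T₁^{(k)}|·Λ]` — (3.92) for the quadratic term
(`½θ_k⟨φ,Δ^{(k)}φ⟩ ≤ ½ΘL^{−2k}a⟨φ,φ⟩`) plus (3.93) for the constants. [cite: King1986, (3.92)–(3.93) p.669] -/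
theorem kingFreeS_diff_rate {a msq : ℝ} (ha : 0 < a) (hL : 2 ≤ L) (hmsq : 0 < msq) (m : ℕ) {k n : ℕ} (hk : 1 ≤ k) (hn : 1 ≤ n)
    (φ : Tor (cubeSide (d := d) M₀ L m) → ℝ) :
    |kingFreeS L M₀ a msq m k φ - kingFreeS L M₀ a msq m (k + n) φ|
      ≤ (thetaUnif a L * ((L : ℝ) ^ (2 * k))⁻¹)
        * ((1 : ℝ) / 2 * a * (φ ⬝ᵥ φ) + (Fintype.card (Tor (cubeSide (d := d) M₀ L m)) : ℝ)
            * (1 + |Real.log (a + unitMassSq msq L m + 4 * d)| + |Real.log (deltaFloor a L (unitMassSq msq L m))|)) := by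
  have hL0 : 0 < L := by omega
  have hm2 : 0 < unitMassSq msq L m := by unfold unitMassSq; exact mul_pos hmsq (pow_pos (eps_pos hL0 m) 2)
  set t : ℝ := thetaUnif a L * ((L : ℝ) ^ (2 * k))⁻¹ with ht
  have ht0 : 0 ≤ t := by rw [ht]; have := thetaUnif_pos ha hL; positivity
  unfold kingFreeS
  rw [kingFreeOp_of_pos L M₀ a msq m hk, kingFreeOp_of_pos L M₀ a msq m (by omega : 1 ≤ k + n)]
  -- the two pieces
  have hq := kingEffLap_forms_rate L (cubeSide (d := d) M₀ L m) ha hL hk hn hm2 φ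
  have hθ : thetaK a L k n ≤ t := thetaK_le ha hL hk hn
  obtain ⟨hδ, _⟩ := deltaFloor_pos_le L ha hL hm2
  have hq0 : 0 ≤ φ ⬝ᵥ (kingEffLap L (cubeSide (d := d) M₀ L m) a (unitMassSq msq L m) k *ᵥ φ) :=
    le_trans (mul_nonneg hδ.le (dotProduct_self_nonneg_real φ)) (kingEffLap_coercive L (cubeSide (d := d) M₀ L m) ha hL hk hm2 φ)
  have hqa : φ ⬝ᵥ (kingEffLap L (cubeSide (d := d) M₀ L m) a (unitMassSq msq L m) k *ᵥ φ) ≤ a * (φ ⬝ᵥ φ) := kingEffLap_form_le L (cubeSide (d := d) M₀ L m) ha hL hk hm2 φ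
  have hquad : |φ ⬝ᵥ (kingEffLap L (cubeSide (d := d) M₀ L m) a (unitMassSq msq L m) k *ᵥ φ) - φ ⬝ᵥ (kingEffLap L (cubeSide (d := d) M₀ L m) a (unitMassSq msq L m) (k + n) *ᵥ φ)| ≤ t * (a * (φ ⬝ᵥ φ)) :=
    hq.trans ((mul_le_mul_of_nonneg_right hθ hq0).trans (mul_le_mul_of_nonneg_left hqa ht0))
  have hconst := log_gaussNorm_rate L ha hL hk hn hm2 (cubeSide (d := d) M₀ L m)
  -- |½(q₁−q₂) + (c₁−c₂)| ≤ ½|q₁−q₂| + |c₁−c₂|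
  have hsplit : (1 : ℝ) / 2 * (φ ⬝ᵥ (kingEffLap L (cubeSide (d := d) M₀ L m) a (unitMassSq msq L m) k *ᵥ φ)) + Real.log (gaussNorm (kingEffLap L (cubeSide (d := d) M₀ L m) a (unitMassSq msq L m) k))
        - ((1 : ℝ) / 2 * (φ ⬝ᵥ (kingEffLap L (cubeSide (d := d) M₀ L m) a (unitMassSq msq L m) (k + n) *ᵥ φ)) + Real.log (gaussNorm (kingEffLap L (cubeSide (d := d) M₀ L m) a (unitMassSq msq L m) (k + n))))
      = (1 : ℝ) / 2 * (φ ⬝ᵥ (kingEffLap L (cubeSide (d := d) M₀ L m) a (unitMassSq msq L m) k *ᵥ φ) - φ ⬝ᵥ (kingEffLap L (cubeSide (d := d) M₀ L m) a (unitMassSq msq L m) (k + n) *ᵥ φ))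
        + (Real.log (gaussNorm (kingEffLap L (cubeSide (d := d) M₀ L m) a (unitMassSq msq L m) k)) - Real.log (gaussNorm (kingEffLap L (cubeSide (d := d) M₀ L m) a (unitMassSq msq L m) (k + n)))) := by ring
  rw [hsplit]
  refine (abs_add_le _ _).trans ?_
  rw [abs_mul, abs_of_pos (by norm_num : (0 : ℝ) < 1 / 2)]
  have h1 : (1 : ℝ) / 2 * |φ ⬝ᵥ (kingEffLap L (cubeSide (d := d) M₀ L m) a (unitMassSq msq L m) k *ᵥ φ) - φ ⬝ᵥ (kingEffLap L (cubeSide (d := d) M₀ L m) a (unitMassSq msq L m) (k + n) *ᵥ φ)| ≤ (1 : ℝ) / 2 * (t * (a * (φ ⬝ᵥ φ))) :=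
    mul_le_mul_of_nonneg_left hquad (by norm_num)
  calc (1 : ℝ) / 2 * |φ ⬝ᵥ (kingEffLap L (cubeSide (d := d) M₀ L m) a (unitMassSq msq L m) k *ᵥ φ) - φ ⬝ᵥ (kingEffLap L (cubeSide (d := d) M₀ L m) a (unitMassSq msq L m) (k + n) *ᵥ φ)|
        + |Real.log (gaussNorm (kingEffLap L (cubeSide (d := d) M₀ L m) a (unitMassSq msq L m) k)) - Real.log (gaussNorm (kingEffLap L (cubeSide (d := d) M₀ L m) a (unitMassSq msq L m) (k + n)))|
      ≤ (1 : ℝ) / 2 * (t * (a * (φ ⬝ᵥ φ)))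
        + (Fintype.card (Tor (cubeSide (d := d) M₀ L m)) : ℝ) * t * (1 + |Real.log (a + unitMassSq msq L m + 4 * d)| + |Real.log (deltaFloor a L (unitMassSq msq L m))|) := add_le_add h1 hconst
    _ = _ := by ring

/-- **THE RATE-FREE MEMBER** (`k = 0`, bare action vs. `Δ^{(n)}`, `n ≥ 1`): `|S^{(0),1}(φ) − S^{(n),1}(φ)| ≤ ½(a + m² + 4d)⟨φ,φ⟩ + ½|T₁|(ln A − ln δ)`
(the crude sandwich of part Τ-a; (3.9) asks for no rate at `k = 0`: `L^{−γ·0} = 1`). [cite: King1986, Thm 3.4 (3.9) p.656] -/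
theorem kingFreeS_diff_zero {a msq : ℝ} (ha : 0 < a) (hL : 2 ≤ L) (hmsq : 0 < msq) (m : ℕ) {n : ℕ} (hn : 1 ≤ n)
    (φ : Tor (cubeSide (d := d) M₀ L m) → ℝ) :
    |kingFreeS L M₀ a msq m 0 φ - kingFreeS L M₀ a msq m n φ|
      ≤ (1 : ℝ) / 2 * (a + unitMassSq msq L m + 4 * d) * (φ ⬝ᵥ φ)
        + (Fintype.card (Tor (cubeSide (d := d) M₀ L m)) : ℝ) / 2
            * (Real.log (a + unitMassSq msq L m + 4 * d) - Real.log (deltaFloor a L (unitMassSq msq L m))) := by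
  have hL0 : 0 < L := by omega
  have hm2 : 0 < unitMassSq msq L m := by unfold unitMassSq; exact mul_pos hmsq (pow_pos (eps_pos hL0 m) 2)
  unfold kingFreeS
  rw [kingFreeOp_zero, kingFreeOp_of_pos L M₀ a msq m hn]
  obtain ⟨hδ, _⟩ := deltaFloor_pos_le L ha hL hm2
  have hφ := dotProduct_self_nonneg_real φ
  have hd0 : (0 : ℝ) ≤ 4 * d := by positivity
  have hA : 0 < a + unitMassSq msq L m + 4 * d := by positivity
  -- bare piece
  have hc0 : Coercive (lapF (cubeSide (d := d) M₀ L m) 1 (unitMassSq msq L m)) (deltaFloor a L (unitMassSq msq L m)) := lapF_coercive_floor (cubeSide (d := d) M₀ L m) ha hL zero_le_one hm2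
  have hq0 : 0 ≤ φ ⬝ᵥ (lapF (cubeSide (d := d) M₀ L m) 1 (unitMassSq msq L m) *ᵥ φ) := le_trans (mul_nonneg hδ.le hφ) (hc0 φ)
  have hq0u : φ ⬝ᵥ (lapF (cubeSide (d := d) M₀ L m) 1 (unitMassSq msq L m) *ᵥ φ) ≤ (unitMassSq msq L m + 4 * d) * (φ ⬝ᵥ φ) := by
    have := lapF_form_le (cubeSide (d := d) M₀ L m) zero_le_one (unitMassSq msq L m) φ; simpa using this
  have hA0 : ∀ x, x ⬝ᵥ (lapF (cubeSide (d := d) M₀ L m) 1 (unitMassSq msq L m) *ᵥ x) ≤ (a + unitMassSq msq L m + 4 * d) * (x ⬝ᵥ x) := fun x => by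
    have h := lapF_form_le (cubeSide (d := d) M₀ L m) zero_le_one (unitMassSq msq L m) x
    have hx := dotProduct_self_nonneg_real x
    simp only [mul_one] at h
    nlinarith
  -- effective piece
  have hcn : Coercive (kingEffLap L (cubeSide (d := d) M₀ L m) a (unitMassSq msq L m) n) (deltaFloor a L (unitMassSq msq L m)) := kingEffLap_coercive L (cubeSide (d := d) M₀ L m) ha hL hn hm2
  have hqn0 : 0 ≤ φ ⬝ᵥ (kingEffLap L (cubeSide (d := d) M₀ L m) a (unitMassSq msq L m) n *ᵥ φ) := le_trans (mul_nonneg hδ.le hφ) (hcn φ)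
  have hqnu : φ ⬝ᵥ (kingEffLap L (cubeSide (d := d) M₀ L m) a (unitMassSq msq L m) n *ᵥ φ) ≤ a * (φ ⬝ᵥ φ) := kingEffLap_form_le L (cubeSide (d := d) M₀ L m) ha hL hn hm2 φ
  have hAn : ∀ x, x ⬝ᵥ (kingEffLap L (cubeSide (d := d) M₀ L m) a (unitMassSq msq L m) n *ᵥ x) ≤ (a + unitMassSq msq L m + 4 * d) * (x ⬝ᵥ x) := fun x =>
    (kingEffLap_form_le L (cubeSide (d := d) M₀ L m) ha hL hn hm2 x).trans (mul_le_mul_of_nonneg_right (by linarith [hm2.le]) (dotProduct_self_nonneg_real x))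
  have hconst := abs_log_gaussNorm_sub_le_crude hδ hA hc0 hA0 hcn hAn
  have hsplit : (1 : ℝ) / 2 * (φ ⬝ᵥ (lapF (cubeSide (d := d) M₀ L m) 1 (unitMassSq msq L m) *ᵥ φ)) + Real.log (gaussNorm (lapF (cubeSide (d := d) M₀ L m) 1 (unitMassSq msq L m)))
        - ((1 : ℝ) / 2 * (φ ⬝ᵥ (kingEffLap L (cubeSide (d := d) M₀ L m) a (unitMassSq msq L m) n *ᵥ φ)) + Real.log (gaussNorm (kingEffLap L (cubeSide (d := d) M₀ L m) a (unitMassSq msq L m) n)))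
      = ((1 : ℝ) / 2 * (φ ⬝ᵥ (lapF (cubeSide (d := d) M₀ L m) 1 (unitMassSq msq L m) *ᵥ φ)) - (1 : ℝ) / 2 * (φ ⬝ᵥ (kingEffLap L (cubeSide (d := d) M₀ L m) a (unitMassSq msq L m) n *ᵥ φ)))
        + (Real.log (gaussNorm (lapF (cubeSide (d := d) M₀ L m) 1 (unitMassSq msq L m))) - Real.log (gaussNorm (kingEffLap L (cubeSide (d := d) M₀ L m) a (unitMassSq msq L m) n))) := by ring
  rw [hsplit]
  refine (abs_add_le _ _).trans ?_
  have h1 : |(1 : ℝ) / 2 * (φ ⬝ᵥ (lapF (cubeSide (d := d) M₀ L m) 1 (unitMassSq msq L m) *ᵥ φ)) - (1 : ℝ) / 2 * (φ ⬝ᵥ (kingEffLap L (cubeSide (d := d) M₀ L m) a (unitMassSq msq L m) n *ᵥ φ))|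
      ≤ (1 : ℝ) / 2 * (a + unitMassSq msq L m + 4 * d) * (φ ⬝ᵥ φ) := by
    rw [abs_le]; constructor <;> nlinarith
  exact add_le_add h1 hconst

end Members2

/-! ## §4 The `ε_m`-bookkeeping: `|T₁^{(k)}| = ε_m^{−d}|T|`, `m²ε_m² ≤ m²`, `Λ ≤ Λ₀ε_m^{−2}`, `R_m² ≤ b₀²L^{2p+2}ε_m^{−2p−2}` -/

section Eps

variable (L : ℕ) [NeZero L] (M₀ : ℕ) [NeZero M₀]

/-- `|T₁^{(k)}| = |T|·ε_m^{−d}` in `rpow` letters. [cite: King1986, p.669] -/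
theorem card_cube_rpow (hL : 2 ≤ L) (m : ℕ) :
    (Fintype.card (Tor (cubeSide (d := d) M₀ L m)) : ℝ) = (M₀ : ℝ) ^ d * eps L m ^ (-(d : ℝ)) := by
  have hε : 0 < eps L m := eps_pos (by omega) m
  rw [card_cube_real, Real.rpow_neg hε.le, Real.rpow_natCast, inv_pow]

/-- The constants letter: `Λ₀(a, L, m², d) = 1 + a + 2m² + 4d + a⁻¹ + (a(1−L⁻²))⁻¹ + (m²)⁻¹`. [folklore] -/
abbrev lambda0 (a : ℝ) (L : ℕ) (msq : ℝ) (d : ℕ) : ℝ :=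
  1 + a + 2 * msq + 4 * d + a⁻¹ + (a * (1 - ((L : ℝ) ^ 2)⁻¹))⁻¹ + msq⁻¹

omit [NeZero L] in
/-- **`1 + |ln(a + m²ε_m² + 4d)| + |ln δ(a,L,m²ε_m²)| ≤ Λ₀·ε_m^{−2}`** (`|ln x| ≤ x + x⁻¹`; `δ⁻¹ = (a(1−L⁻²))⁻¹ + (m²ε_m²)⁻¹`). [folklore] -/
theorem lambda_le {a msq : ℝ} (ha : 0 < a) (hL : 2 ≤ L) (hmsq : 0 < msq) (m : ℕ) :
    1 + |Real.log (a + unitMassSq msq L m + 4 * d)| + |Real.log (deltaFloor a L (unitMassSq msq L m))|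
      ≤ lambda0 a L msq d * eps L m ^ (-(2 : ℝ)) := by
  have hL0 : 0 < L := by omega
  have hε : 0 < eps L m := eps_pos hL0 m
  have hε1 : eps L m ≤ 1 := eps_le_one (by omega) m
  have hm2 : 0 < unitMassSq msq L m := by unfold unitMassSq; exact mul_pos hmsq (pow_pos hε 2)
  have hm2le : unitMassSq msq L m ≤ msq := by
    unfold unitMassSq
    have : eps L m ^ 2 ≤ 1 := pow_le_one₀ hε.le hε1
    nlinarith
  have h1 := one_sub_invSq_pos hL
  have hamin : 0 < a * (1 - ((L : ℝ) ^ 2)⁻¹) := mul_pos ha h1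
  obtain ⟨hδ, hδle⟩ := deltaFloor_pos_le L ha hL hm2
  have hd0 : (0 : ℝ) ≤ 4 * d := by positivity
  have hA : 0 < a + unitMassSq msq L m + 4 * d := by positivity
  -- the letter |ln x| ≤ x + x⁻¹
  have abs_log_le_add_inv : ∀ {x : ℝ}, 0 < x → |Real.log x| ≤ x + x⁻¹ := fun {x} hx => by
    have h1 : Real.log x ≤ x - 1 := Real.log_le_sub_one_of_pos hx
    have h2 : Real.log x⁻¹ ≤ x⁻¹ - 1 := Real.log_le_sub_one_of_pos (inv_pos.mpr hx)
    rw [Real.log_inv] at h2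
    rw [abs_le]
    constructor <;> nlinarith [inv_pos.mpr hx]
  -- |ln A| ≤ A + A⁻¹ ≤ (a + msq + 4d) + a⁻¹
  have hlogA : |Real.log (a + unitMassSq msq L m + 4 * d)| ≤ a + msq + 4 * d + a⁻¹ := by
    have h := abs_log_le_add_inv hA
    have hinv : (a + unitMassSq msq L m + 4 * d)⁻¹ ≤ a⁻¹ := inv_anti₀ ha (by linarith [hm2.le])
    linarith
  -- |ln δ| ≤ δ + δ⁻¹ ≤ msq + amin⁻¹ + (msq ε²)⁻¹
  have hε2 : eps L m ^ (-(2 : ℝ)) = (eps L m ^ 2)⁻¹ := by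
    rw [Real.rpow_neg hε.le, show (2 : ℝ) = ((2 : ℕ) : ℝ) by norm_num, Real.rpow_natCast]
  have hε2ge : 1 ≤ eps L m ^ (-(2 : ℝ)) := by
    rw [hε2]; exact one_le_inv_iff₀.mpr ⟨pow_pos hε 2, pow_le_one₀ hε.le hε1⟩
  have hlogδ : |Real.log (deltaFloor a L (unitMassSq msq L m))| ≤ msq + (a * (1 - ((L : ℝ) ^ 2)⁻¹))⁻¹ + msq⁻¹ * eps L m ^ (-(2 : ℝ)) := by
    have h := abs_log_le_add_inv hδ
    have hinvδ : (deltaFloor a L (unitMassSq msq L m))⁻¹ = (a * (1 - ((L : ℝ) ^ 2)⁻¹))⁻¹ + (unitMassSq msq L m)⁻¹ := by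
      unfold deltaFloor; rw [inv_inv]
    have hm2inv : (unitMassSq msq L m)⁻¹ = msq⁻¹ * eps L m ^ (-(2 : ℝ)) := by
      unfold unitMassSq; rw [hε2, mul_inv]
    rw [hinvδ, hm2inv] at h
    linarith
  have hpos : 0 ≤ 1 + a + 2 * msq + 4 * d + a⁻¹ + (a * (1 - ((L : ℝ) ^ 2)⁻¹))⁻¹ := by positivity
  calc 1 + |Real.log (a + unitMassSq msq L m + 4 * d)| + |Real.log (deltaFloor a L (unitMassSq msq L m))|
      ≤ (1 + a + 2 * msq + 4 * d + a⁻¹ + (a * (1 - ((L : ℝ) ^ 2)⁻¹))⁻¹) * 1 + msq⁻¹ * eps L m ^ (-(2 : ℝ)) := by linarith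
    _ ≤ (1 + a + 2 * msq + 4 * d + a⁻¹ + (a * (1 - ((L : ℝ) ^ 2)⁻¹))⁻¹) * eps L m ^ (-(2 : ℝ)) + msq⁻¹ * eps L m ^ (-(2 : ℝ)) := by
        have := mul_le_mul_of_nonneg_left hε2ge hpos; linarith
    _ = lambda0 a L msq d * eps L m ^ (-(2 : ℝ)) := by unfold lambda0; ring

omit [NeZero L] in
/-- `½(ln A − ln δ) ≤ Λ ≤ Λ₀ε^{−2}` (the `k = 0` member's constants). [folklore] -/
theorem half_log_sub_le {a msq : ℝ} (ha : 0 < a) (hL : 2 ≤ L) (hmsq : 0 < msq) (m : ℕ) :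
    (1 : ℝ) / 2 * (Real.log (a + unitMassSq msq L m + 4 * d) - Real.log (deltaFloor a L (unitMassSq msq L m)))
      ≤ lambda0 a L msq d * eps L m ^ (-(2 : ℝ)) := by
  refine le_trans ?_ (lambda_le L ha hL hmsq m)
  have h1 := le_abs_self (Real.log (a + unitMassSq msq L m + 4 * d))
  have h2 := neg_abs_le (Real.log (deltaFloor a L (unitMassSq msq L m)))
  have h3 := abs_nonneg (Real.log (a + unitMassSq msq L m + 4 * d))
  have h4 := abs_nonneg (Real.log (deltaFloor a L (unitMassSq msq L m)))
  linarith

omit [NeZero L] in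
/-- Monotonicity of `ε_m^{−s}` in `s` (`0 < ε_m ≤ 1`). [folklore] -/
theorem eps_rpow_neg_mono (hL : 2 ≤ L) (m : ℕ) {s t : ℝ} (hst : s ≤ t) : eps L m ^ (-s) ≤ eps L m ^ (-t) :=
  Real.rpow_le_rpow_of_exponent_ge (eps_pos (by omega) m) (eps_le_one (by omega) m) (by linarith)

/-- **On the small-field set**: `⟨φ, φ⟩ ≤ |T|·b₀²L^{2p+2}·ε_m^{−(d+2p+2)}`. [cite: King1986, (3.2) p.655, (3.92) p.669] -/
theorem dotProduct_self_le_eps {b₀ p : ℝ} (hL : 2 ≤ L) (hb : 0 ≤ b₀) (hp : 0 ≤ p) {m : ℕ} {φ : Tor (cubeSide (d := d) M₀ L m) → ℝ}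
    (hχ : kingFreeChi L M₀ b₀ p m φ = 1) :
    φ ⬝ᵥ φ ≤ (M₀ : ℝ) ^ d * (b₀ ^ 2 * (L : ℝ) ^ (2 * p + 2)) * eps L m ^ (-((d : ℝ) + 2 * p + 2)) := by
  have hε : 0 < eps L m := eps_pos (by omega) m
  have h1 := dotProduct_self_le_of_chi hχ
  have h2 := threshold_sq_le (d := d) hL hb hp m
  rw [card_cube_rpow L M₀ hL m] at h1
  have hcard : 0 ≤ (M₀ : ℝ) ^ d * eps L m ^ (-(d : ℝ)) := by positivity
  calc φ ⬝ᵥ φ ≤ (M₀ : ℝ) ^ d * eps L m ^ (-(d : ℝ)) * kingFreeThreshold d b₀ p L m ^ 2 := h1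
    _ ≤ (M₀ : ℝ) ^ d * eps L m ^ (-(d : ℝ)) * (b₀ ^ 2 * (L : ℝ) ^ (2 * p + 2) * eps L m ^ (-(2 * p + 2))) :=
        mul_le_mul_of_nonneg_left h2 hcard
    _ = (M₀ : ℝ) ^ d * (b₀ ^ 2 * (L : ℝ) ^ (2 * p + 2)) * (eps L m ^ (-(d : ℝ)) * eps L m ^ (-(2 * p + 2))) := by ring
    _ = _ := by rw [← Real.rpow_add hε]; ring_nf

end Eps

end Summit.QuantumFields.YangMills.BalabanUVNodes.N15KingModelRung.FreeField

end
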